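import Literature.AnabelianGeometry.SemiGraphs.ImmersionLiftUnique
import Literature.AnabelianGeometry.SemiGraphs.TreeSystemFixedPointTopological
import Literature.AnabelianGeometry.SemiGraphs.TemperedLevelDataCpt

/-!
# Compact subgroups acting trivially on a finite level act trivially on its tree ([SemiAnbd] Thm 3.7 (iii) / Thm 5.4)

Mochizuki, *Semi-graphs of anabelioids*, Publ. RIMS **42** (2006), §3, proof of Thm. 3.7 (iii), author's
manuscript p. 41 [cite: MochizukiSemiAnbd2006, Thm 3.7(iii) p.41] ("`H ⊆ π₁^temp(𝒢)` [compact] … acts on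
`𝒢_{∞,i}` … this action factors through a finite quotient … by Lemma 1.8 (ii) … `H` fixes at least one
vertex of `𝒢_{∞,i}`"), §1 Prop. 1.1 p. 14 (immersions are rigid: unique lifting), §5 Thm. 5.4 p. 66
(the arithmetic analogue, "compact subgroups … arithmetically ample").

A GENERIC consequence for the cell's level-data structures (finding F-t6g3-1, ruling α12-1, and its
arithmetic twin (A54)): in `FiniteLevelData` / `FiniteLevelDataCpt` (seats abc-iut-L3-t10 / -t6) and in
`ArithLevelData` (seat abc-iut-w4-d053) the tree action `act j` covers the finite-level action `levelAct j`
through the graph-covering `quot j : tree j ⟶ level j`, an IMMERSION.  Hence **an element of a COMPACT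
subgroup acting trivially on the finite level `𝔾_j` acts trivially on the tree `𝒢_{∞,j}`**: the compact
subgroup acts on the tree through a finite quotient (open kernel), so it fixes a vertex (Lemma 1.8 (ii),
no branch switching over the base), and an automorphism of the connected tree lying over the identity of
`𝔾_j` through the immersion `quot j` which fixes a vertex is the identity (Prop. 1.1 rigidity,
`SemiGraph.aut_eq_one_of_comp_eq_of_vertexMap_eq`).  So for compact subgroups the joint kernel of the
LEVEL actions lies in the joint kernel of the TREE actions — the reduction used by the producers of
(I4′)_cpt / (AI4′)_cpt («injective on compact subgroups»); without compactness this fails (lazy towers,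
F-t6g3-1: a nontrivial deck translation acts trivially on every finite level).  Proof-only (seat
abc-iut-L3-t6); nothing here bears on [IUTchIII] Cor. 3.12.
-/

namespace Literature.AnabelianGeometry.SemiGraphs

open CategoryTheory Topology

universe v u u' u'' w

namespace SemiGraph

/-- **Generic core**: a compact subgroup `C` of a topological group acting on a tree `T` OVER a base `𝔾`
through a homomorphism with open kernel, and an immersion `q : T ⟶ L`; if the action of `g ∈ C` lies
over the identity of `L` through `q`, then `g` acts trivially on `T`.
[cite: MochizukiSemiAnbd2006, Thm 3.7(iii) p.41] -/
theorem act_eq_one_of_isCompact_of_comp_immersion_eq {P : Type w} [Group P] [TopologicalSpace P]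
    [IsTopologicalGroup P] (C : Subgroup P) (hC : IsCompact (C : Set P))
    {T 𝔾 L : SemiGraph.{u}} (hT : T.IsTree) (v₀ : T.Vertex) (p : T ⟶ 𝔾) (ρ : P →* Aut T)
    (hker : IsOpen (ρ.ker : Set P)) (hover : ∀ g : P, (ρ g).hom ≫ p = p)
    (q : T ⟶ L) (hq : IsImmersion q) {g : P} (hg : g ∈ C) (hgq : (ρ g).hom ≫ q = q) : ρ g = 1 := by
  obtain ⟨x, hx⟩ := exists_fixed_vertex_of_isCompact_over C hC hT v₀ p ρ hker hover
  exact aut_eq_one_of_comp_eq_of_vertexMap_eq q hq ⟨hT.isTree.1⟩ (ρ g) hgq x (hx ⟨g, hg⟩)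

/-- The same with the «no branch switching» hypothesis in place of «over a base» (the arithmetic setting,
where the base graph itself is moved). [cite: MochizukiSemiAnbd2006, Thm 5.4 (i), p. 66] -/
theorem act_eq_one_of_isCompact_of_noSwap_of_comp_immersion_eq {P : Type w} [Group P]
    [TopologicalSpace P] [IsTopologicalGroup P] (C : Subgroup P) (hC : IsCompact (C : Set P))
    {T L : SemiGraph.{u}} (hT : T.IsTree) (v₀ : T.Vertex) (ρ : P →* Aut T)
    (hker : IsOpen (ρ.ker : Set P))
    (hnoswap : ∀ (g : P) (b : T.Branch), (ρ g).hom.edgeMap (T.edgeOf b) = T.edgeOf b →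
      (ρ g).hom.branchMap b = b)
    (q : T ⟶ L) (hq : IsImmersion q) {g : P} (hg : g ∈ C) (hgq : (ρ g).hom ≫ q = q) : ρ g = 1 := by
  have habut : ∀ e : T.Edge, ∃ b : T.Branch, T.edgeOf b = e ∧ (T.abuts b).isSome :=
    fun e => exists_abuts_of_isConnected ⟨hT.isTree.1⟩ v₀ e
  have hfin : (Set.range (ρ.restrict C)).Finite := finite_range_restrict_of_isCompact ρ hker C hC
  obtain ⟨x, hx⟩ := exists_fixed_vertex_of_noSwap hT habut (ρ.restrict C) hfin
    (fun c b he => hnoswap c b he)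
  exact aut_eq_one_of_comp_eq_of_vertexMap_eq q hq ⟨hT.isTree.1⟩ (ρ g) hgq x (hx ⟨g, hg⟩)

end SemiGraph

namespace ProfiniteSemiGraph

variable {𝒢 : ProfiniteSemiGraph.{u}} {c : TemperedPiChart 𝒢}

namespace FiniteLevelData

/-- **For finite-level data of a chart: an element of a compact subgroup acting trivially on the finite
level `𝔾_j` acts trivially on the tree `𝒢_{∞,j}`** (finite quotient ⇒ fixed vertex; `quot j` is an
immersion and `act_quot` puts `act j g` over the identity ⇒ rigidity). [cite: MochizukiSemiAnbd2006, Thm 3.7(iii) p.41] -/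
theorem act_eq_one_of_levelAct_eq_one (D : FiniteLevelData.{v} 𝒢 c) (C : Subgroup c.G)
    (hC : IsCompact (C : Set c.G)) {g : c.G} (hg : g ∈ C) (j : D.J) (htriv : D.levelAct j g = 1) :
    D.act j g = 1 := by
  refine SemiGraph.act_eq_one_of_isCompact_of_comp_immersion_eq C hC (D.isTree j) (D.vertex j) (D.proj j)
    (D.act j) (D.isOpen_ker j) (D.act_over j) (D.quot j) (D.quot_isImmersion j) hg ?_
  rw [D.act_quot j g, htriv]
  exact Category.comp_id _

/-- Joint form: on a compact subgroup, the joint kernel of the finite-level actions lies in the joint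
kernel of the tree actions. [cite: MochizukiSemiAnbd2006, Thm 3.7(iii) p.41] -/
theorem forall_act_eq_one_of_forall_levelAct_eq_one (D : FiniteLevelData.{v} 𝒢 c) (C : Subgroup c.G)
    (hC : IsCompact (C : Set c.G)) {g : c.G} (hg : g ∈ C) (htriv : ∀ j, D.levelAct j g = 1) (j : D.J) :
    D.act j g = 1 :=
  D.act_eq_one_of_levelAct_eq_one C hC hg j (htriv j)

end FiniteLevelData

namespace FiniteLevelDataCpt

/-- **Compact-form data (v4): an element of a compact subgroup acting trivially on the finite level `𝔾_j`
acts trivially on the tree `𝒢_{∞,j}`.** [cite: MochizukiSemiAnbd2006, Thm 3.7(iii) p.41] -/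
theorem act_eq_one_of_levelAct_eq_one (D : FiniteLevelDataCpt.{v} 𝒢 c) (C : Subgroup c.G)
    (hC : IsCompact (C : Set c.G)) {g : c.G} (hg : g ∈ C) (j : D.J) (htriv : D.levelAct j g = 1) :
    D.act j g = 1 := by
  refine SemiGraph.act_eq_one_of_isCompact_of_comp_immersion_eq C hC (D.isTree j) (D.vertex j) (D.proj j)
    (D.act j) (D.isOpen_ker j) (D.act_over j) (D.quot j) (D.quot_isImmersion j) hg ?_
  rw [D.act_quot j g, htriv]
  exact Category.comp_id _

/-- Joint form for compact-form data. [cite: MochizukiSemiAnbd2006, Thm 3.7(iii) p.41] -/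
theorem forall_act_eq_one_of_forall_levelAct_eq_one (D : FiniteLevelDataCpt.{v} 𝒢 c) (C : Subgroup c.G)
    (hC : IsCompact (C : Set c.G)) {g : c.G} (hg : g ∈ C) (htriv : ∀ j, D.levelAct j g = 1) (j : D.J) :
    D.act j g = 1 :=
  D.act_eq_one_of_levelAct_eq_one C hC hg j (htriv j)

end FiniteLevelDataCpt

end ProfiniteSemiGraph

namespace ArithLevelData

variable {Gtp : Type u'} [Group Gtp] [TopologicalSpace Gtp] [IsTopologicalGroup Gtp] {PA : Type u''}
  [Group PA] {𝔾 : SemiGraph.{u}} {D : DecompositionData Gtp 𝔾.Vertex 𝔾.Branch} {aug : Gtp →* PA}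
  {baseAct : PA →* Aut 𝔾} (L : ArithLevelData.{v} 𝔾 D aug baseAct)

/-- **Arithmetic level data ([SemiAnbd] Thm 5.4): an element of a compact subgroup of `Π^temp_𝔊` acting
trivially on the finite level `𝔾_j` acts trivially on the tree `𝒢_{∞,j}`** (finite quotient + no branch
switching `noSwap` ⇒ fixed vertex; `quot j` immersion + `act_quot` ⇒ rigidity).  This is the reduction
«level-trivial ⇒ tree-trivial on compact subgroups» needed by the producer of the compact-form branch
identification (AI4′)_cpt. [cite: MochizukiSemiAnbd2006, Thm 5.4 (i), p. 66] -/
theorem act_eq_one_of_levelAct_eq_one (C : Subgroup Gtp) (hC : IsCompact (C : Set Gtp)) {g : Gtp}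
    (hg : g ∈ C) (j : L.J) (htriv : L.levelAct j g = 1) : L.act j g = 1 := by
  refine SemiGraph.act_eq_one_of_isCompact_of_noSwap_of_comp_immersion_eq C hC (L.isTree j) (L.vertex j)
    (L.act j) (L.isOpen_ker j) (fun g' b he => L.noSwap j g' b he) (L.quot j) (L.quot_isImmersion j) hg ?_
  rw [L.act_quot j g, htriv]
  exact Category.comp_id _

/-- Joint form for arithmetic level data. [cite: MochizukiSemiAnbd2006, Thm 5.4 (i), p. 66] -/
theorem forall_act_eq_one_of_forall_levelAct_eq_one (C : Subgroup Gtp) (hC : IsCompact (C : Set Gtp))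
    {g : Gtp} (hg : g ∈ C) (htriv : ∀ j, L.levelAct j g = 1) (j : L.J) : L.act j g = 1 :=
  L.act_eq_one_of_levelAct_eq_one C hC hg j (htriv j)

end ArithLevelData

end Literature.AnabelianGeometry.SemiGraphs
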